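import Literature.AnabelianGeometry.EtaleTheta.ThetaTrivializations
import Literature.AnabelianGeometry.EtaleTheta.SettingModel
import HarnessLib

/-!
# [EtTh] §1, Prop. 1.1 / Lem. 1.2: a TOY inhabitant of `LineBundleData` — the three named facts
# `Prop11i`, `Prop11ii`, `Lem12` are jointly satisfiable over every theta setting (vacuity lane)

Mochizuki, *The étale theta function …*, Publ. RIMS **45** (2009) [EtTh], §1, Prop. 1.1 (p. 15) and
Lem. 1.2 (p. 19) [cite: MochizukiEtTh2009, Prop 1.1 p.15]. Layer L2 of the abc-iut cell, seat
abc-iut-L2-t1 (§1 interface owner); proof/definition-only sequel of `ThetaTrivializations.lean`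
(FACT-LIST F-0653 `Lem12`, F-0654 `Prop11i`, F-0655 `Prop11ii`) and of the root model `SettingModel.lean`.

WHAT. The interface `ThetaSetting.LineBundleData` (sections of `L_N`, `L̈_N`, automorphism groups of the
geometric line bundles, theta trivialisations — formal schemes have no carrier) had NO producer in the
kernel (abc-iut-w5-d197 census 04:17Z). This file gives, for EVERY `D : ThetaSetting p`, the toy datum
`LineBundleData.toy D` (all section types `Unit`; `Aut V(L_N ⊗ O_{J_N}) := Π^tp_X/Π^tp_{Z_N}` with the
quotient map as the unique "compatible" action; `Aut(Ÿ_N, V(L̈_N)) := ℤ/2N` with the roots of unity acting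
by the identity and the Prop. 1.1 action trivial) and PROVES `Prop11i`, `Prop11ii`, `Lem12` for it
(`prop11i_toy`, `prop11ii_toy`, `lem12_toy`); with `ThetaSetting.model p` this yields
`exists_setting_lineBundleData_facts : ∃ D L, D.IsEtThOrigin ∧ Prop11i L ∧ Prop11ii L ∧ Lem12 L`.
READING (numbers, not opinions): (1) the three facts are CONSISTENT with the root interface as typed —
no refutation-as-typed is possible; (2) equally, they are satisfiable by TRIVIAL data, i.e. as typed their
content lives entirely in the data interface `LineBundleData` (whose faithful producer needs formal models
of `Ÿ_N` — campaign-size): consumers of F-0653/4/5 get nothing beyond what they put into `L`. A toy is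
consistency evidence only; nothing of [EtTh] is asserted; no side is taken on [IUTchIII] Cor. 3.12.
-/

noncomputable section

namespace Literature.AnabelianGeometry.EtaleTheta

open Literature.AnabelianGeometry.SemiGraphs

namespace ThetaSetting

variable {p : ℕ} [Fact p.Prime] (D : ThetaSetting p)

/-- **Toy line-bundle data** over an arbitrary theta setting: section types `Unit`;
`Aut V(L_N ⊗ O_{J_N}) := Π^tp_X/Π^tp_{Z_N}` (so that "factors through `Gal(Z_N/X)`, faithful on
`Δ^tp_X/Δ^tp_{Z_N}`" holds on the nose), compatibility := "is the quotient map"; `Aut(Ÿ_N, V(L̈_N)) := ℤ/2N`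
with `rootAct = id`, Prop. 1.1 action trivial, all predicates `True`. [cite: MochizukiEtTh2009, Prop 1.1 p.15] -/
def LineBundleData.toy : D.LineBundleData where
  SecPow _ := Unit
  Sec _ := Unit
  powN _ _ := ()
  s₁res _ := ()
  AutV N := D.PiTemp ⧸ D.GtpZN N
  instGroupAutV N := @QuotientGroup.Quotient.group _ _ (D.GtpZN N) (D.GtpZN_normal N)
  IsCompatibleWith N ρ _ := ρ = @QuotientGroup.mk' _ _ (D.GtpZN N) (D.GtpZN_normal N)
  SecDd _ := Unit
  IsThetaTriv _ _ := True
  SecMix _ _ _ := Unit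
  powDd _ _ _ _ := ()
  pullDd _ _ _ _ := ()
  AutVdd N := Multiplicative (ZMod (2 * N))
  Preserves _ _ _ := True
  rootAct _ := MonoidHom.id _
  rootAct_injective _ := Function.injective_id
  AutCompat _ _ _ _ _ := True
  actProp11 _ := 1

/-- `Prop11i` holds for the toy datum (the `N`-th root of `()` is `()`). [cite: MochizukiEtTh2009, Prop 1.1 (i) p.15] -/
theorem prop11i_toy : Prop11i (LineBundleData.toy D) := fun _ => ⟨(), rfl⟩

/-- `Prop11ii` holds for the toy datum: the quotient map `Π^tp_X ↠ Π^tp_X/Π^tp_{Z_N}` is the unique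
"compatible" action, its kernel is `Π^tp_{Z_N}` and meets `Δ^tp_X` in `Δ^tp_{Z_N}`. [cite: MochizukiEtTh2009, Prop 1.1 (ii) p.15] -/
theorem prop11ii_toy : Prop11ii (LineBundleData.toy D) := by
  intro N sN _
  haveI := D.GtpZN_normal N
  refine ⟨QuotientGroup.mk' (D.GtpZN N), rfl, fun ρ' h => h, ?_, ?_⟩
  · exact (QuotientGroup.ker_mk' (D.GtpZN N)).ge
  · show (QuotientGroup.mk' (D.GtpZN N)).ker ⊓ D.Dtp = D.DtpZN N
    rw [QuotientGroup.ker_mk']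
    rfl

/-- `Lem12` holds for the toy datum (all trivialisations `()`, all actions trivial, all roots of unity `1`).
[cite: MochizukiEtTh2009, Lem 1.2 p.19] -/
theorem lem12_toy : Lem12 (LineBundleData.toy D) := by
  refine ⟨fun _ => (), fun _ => trivial, fun _ _ _ => rfl, fun _ => 1, fun _ _ => trivial,
    fun _ _ _ _ => trivial, fun N g => ⟨1, ?_⟩, fun N g hg => ⟨1, ?_⟩⟩
  · show (1 : D.GtpY →* Multiplicative (ZMod (2 * N))) g = MonoidHom.id _ 1 * (1 : D.GtpY →* _) g
    simp
  · show (1 : D.GtpY →* Multiplicative (ZMod (2 * N))) _ = MonoidHom.id _ (1 * 1) * (1 : D.GtpY →* _) _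
    simp

/-- **Joint satisfiability** of F-0653/F-0654/F-0655 with the data interface, over EVERY theta setting.
[cite: MochizukiEtTh2009, Lem 1.2 p.19] -/
theorem exists_lineBundleData_facts :
    ∃ L : D.LineBundleData, Prop11i L ∧ Prop11ii L ∧ Lem12 L :=
  ⟨LineBundleData.toy D, prop11i_toy D, prop11ii_toy D, lem12_toy D⟩

/-- … and together with the root model and its guard: `∃ D L, D.IsEtThOrigin ∧ Prop11i L ∧ Prop11ii L ∧ Lem12 L`
— the Prop. 1.1 / Lem. 1.2 facts cannot be refuted as typed (toy; their content is in the data).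
[cite: MochizukiEtTh2009, Lem 1.2 p.19] -/
theorem exists_setting_lineBundleData_facts :
    ∃ (D' : ThetaSetting p) (L : D'.LineBundleData), D'.IsEtThOrigin ∧ Prop11i L ∧ Prop11ii L ∧ Lem12 L :=
  ⟨ThetaSetting.model p, LineBundleData.toy _, ThetaSetting.model_isEtThOrigin p,
    prop11i_toy _, prop11ii_toy _, lem12_toy _⟩

end ThetaSetting

end Literature.AnabelianGeometry.EtaleTheta

end
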